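import Mathlib
import Summits.Ventures.PercRepro2.Defs
import Summits.Ventures.PercRepro2.Independence
import Summits.Ventures.PercRepro2.Harris
import Summits.Ventures.PercRepro2.Graph
import Summits.Ventures.PercRepro2.Exploration
import Summits.Ventures.PercRepro2.Events
import Summits.Ventures.PercRepro2.FourFunctions
import Summits.Ventures.PercRepro2.Induced
import Summits.Ventures.PercRepro2.Frontier
import Summits.Ventures.PercRepro2.ObsIndependence
import Summits.Ventures.PercRepro2.BHK
import Summits.Ventures.PercRepro2.BHKEvents
import Summits.Ventures.PercRepro2.MultiSource
import Summits.Ventures.PercRepro2.OrderPreservation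
import Summits.Ventures.PercRepro2.SeedSet
import Summits.Ventures.PercRepro2.MultiSourceFun
import Summits.Ventures.PercRepro2.CrossRootT
import Summits.Ventures.PercRepro2.VdBKahn
import Summits.Ventures.PercRepro2.HullDefs
import Summits.Ventures.PercRepro2.CCTRootEdge
import Summits.Ventures.PercRepro2.PASubDefs

/-!
# Theorem PA-sub, part 2: the seed-set BHK under the `e`-open measure and the theorem (blind cell
PercRepro2, typer-1; mine-c g3 `proofs/MINEC-THEOREMS.md` Theorem PA-sub, INBOX 2026-08-23T11:03:51Z)

On top of `PASubDefs`: `expect_update_one_K` transfers the law of the `e`-open seed cluster `K`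
(`E_{p[e↦1]}[f(C(T)) 1_{T ↮ s}] = Σ_W [s ∉ W] f(W) P(K = W)`), and **`paSub`**:
`P(X⁻ ∩ R⁺) · P(Y⁻ ∩ R⁺) ≤ P(X⁻ ∩ Y⁻ ∩ R⁺) · P(R⁺)` — the partition by `K`, independence of `X_W`
from `{K = W}`, Harris for `X_W ∩ Y_W`, and `bhk_multi` for the seed set `T` avoiding `{s}` applied to
the decreasing functionals `x̄, ȳ` (through `1 − x̄`, `1 − ȳ`).
-/

namespace Summit.Ventures.PercRepro2

namespace PASub

open scoped Classical

variable {V : Type*} {E : Type*} [Fintype E] [DecidableEq E] [Fintype V] [DecidableEq V]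
  {R : Type*} [Field R] [LinearOrder R] [IsStrictOrderedRing R]

/-! ## The seed-set BHK under the `e`-open measure, and the theorem -/

section Main

variable (p : E → R) (ends : E → Sym2 V) (e : E) (s : V) (T : Finset V)

omit [Fintype E] [DecidableEq V] [Fintype V] in
/-- `ω⁺` avoids `{s}` as a seed set iff `s ∉ K`. -/
lemma update_true_mem_avoidAllT_iff (ω : Config E) :
    Function.update ω e true ∈ avoidAllT ends T {s} ↔ s ∉ Kset ends e T ω := by
  simp only [avoidAllT, Set.mem_setOf_eq, Finset.mem_singleton, forall_eq, Kset, mem_clusterSet,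
    not_exists, not_and]

omit [Fintype E] [DecidableEq V] [Fintype V] [LinearOrder R] [IsStrictOrderedRing R] in
/-- `R⁺` as the seed-set avoidance of `{s}` under `ω⁺`. -/
lemma Rplus_eq : Rplus ends e s T = {ω | Function.update ω e true ∈ avoidAllT ends T {s}} := by
  ext ω
  rw [mem_Rplus_iff, Set.mem_setOf_eq, update_true_mem_avoidAllT_iff]

omit [DecidableEq V] [LinearOrder R] [IsStrictOrderedRing R] in
/-- Transfer of the seed-set law: `E_{p[e↦1]}[f(C(T)) · 1_{T ↮ s}] = Σ_W [s ∉ W] f(W) P(K = W)`. -/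
lemma expect_update_one_K (f : Set V → R) :
    expect (Function.update p e 1)
        (fun ω => f (clusterSet ends ω T) * (avoidAllT ends T {s}).indicator 1 ω) =
      ∑ W : Set V, if s ∉ W then f W * prob p (KEvent ends e T W) else 0 := by
  rw [expect_update_one]
  unfold expect prob
  have hmove : ∀ W : Set V,
      (if s ∉ W then f W * ∑ ω, (KEvent ends e T W).indicator (weight p) ω else 0) =
        ∑ ω, if s ∉ W then f W * (KEvent ends e T W).indicator (weight p) ω else 0 := by
    intro W
    split_ifs <;> simp [Finset.mul_sum]
  simp_rw [hmove]
  rw [Finset.sum_comm]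
  refine Finset.sum_congr rfl fun ω _ => ?_
  rw [Finset.sum_eq_single (Kset ends e T ω)]
  · by_cases hs : s ∉ Kset ends e T ω
    · have h1 : ω ∈ KEvent ends e T (Kset ends e T ω) := rfl
      rw [if_pos hs, Set.indicator_of_mem h1,
        Set.indicator_of_mem ((update_true_mem_avoidAllT_iff ends e s T ω).2 hs)]
      simp only [Kset, Pi.one_apply, mul_one]
      ring
    · rw [if_neg hs, Set.indicator_of_notMem
        (fun h => hs ((update_true_mem_avoidAllT_iff ends e s T ω).1 h))]
      simp
  · intro W _ hW
    by_cases hs : s ∉ W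
    · have h2 : ω ∉ KEvent ends e T W := fun h => hW h.symm
      rw [if_pos hs, Set.indicator_of_notMem h2]
      simp
    · rw [if_neg hs]
  · intro h
    exact absurd (Finset.mem_univ _) h

/-- **Theorem PA-sub** (mine-c): the `e`-closed connection events are positively associated under
the `e`-open avoidance event, `P(X⁻ ∩ R⁺) P(Y⁻ ∩ R⁺) ≤ P(X⁻ ∩ Y⁻ ∩ R⁺) P(R⁺)`. -/
theorem paSub (hp : IsProbVec p) (a b : V) :
    prob p (Xminus ends e s a ∩ Rplus ends e s T) *
        prob p (Xminus ends e s b ∩ Rplus ends e s T) ≤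
      prob p (Xminus ends e s a ∩ Xminus ends e s b ∩ Rplus ends e s T) *
        prob p (Rplus ends e s T) := by
  have hp₁ : IsProbVec (Function.update p e 1) := hp.update e zero_le_one le_rfl
  -- the partition identities
  have hpart : ∀ (A : Set (Config E)) (g : Set V → R),
      (∀ W, s ∉ W → prob p (A ∩ KEvent ends e T W) = g W * prob p (KEvent ends e T W)) →
      prob p (A ∩ Rplus ends e s T) =
        ∑ W : Set V, if s ∉ W then g W * prob p (KEvent ends e T W) else 0 := by
    intro A g hg
    rw [prob_inter_Rplus_eq_sum]
    refine Finset.sum_congr rfl fun W _ => ?_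
    by_cases hs : s ∉ W
    · rw [if_pos hs, if_pos hs, hg W hs]
    · rw [if_neg hs, if_neg hs]
  have hX : prob p (Xminus ends e s a ∩ Rplus ends e s T) =
      ∑ W : Set V, if s ∉ W then prob p (Xdel ends e s W a) * prob p (KEvent ends e T W) else 0 := by
    refine hpart _ _ fun W hs => ?_
    rw [← prob_Xdel_inter_KEvent]
    congr 1
    ext ω
    simp only [Set.mem_inter_iff]
    constructor
    · rintro ⟨hx, hK⟩; exact ⟨(mem_X_iff_of_K ends e s T hK hs a).1 hx, hK⟩
    · rintro ⟨hx, hK⟩; exact ⟨(mem_X_iff_of_K ends e s T hK hs a).2 hx, hK⟩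
  have hY : prob p (Xminus ends e s b ∩ Rplus ends e s T) =
      ∑ W : Set V, if s ∉ W then prob p (Xdel ends e s W b) * prob p (KEvent ends e T W) else 0 := by
    refine hpart _ _ fun W hs => ?_
    rw [← prob_Xdel_inter_KEvent]
    congr 1
    ext ω
    simp only [Set.mem_inter_iff]
    constructor
    · rintro ⟨hx, hK⟩; exact ⟨(mem_X_iff_of_K ends e s T hK hs b).1 hx, hK⟩
    · rintro ⟨hx, hK⟩; exact ⟨(mem_X_iff_of_K ends e s T hK hs b).2 hx, hK⟩
  have hXY : prob p (Xminus ends e s a ∩ Xminus ends e s b ∩ Rplus ends e s T) =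
      ∑ W : Set V, if s ∉ W then
        prob p (Xdel ends e s W a ∩ Xdel ends e s W b) * prob p (KEvent ends e T W) else 0 := by
    refine hpart _ _ fun W hs => ?_
    rw [← prob_Xdel_inter_Xdel_inter_KEvent]
    congr 1
    ext ω
    simp only [Set.mem_inter_iff]
    constructor
    · rintro ⟨⟨hx, hy⟩, hK⟩
      exact ⟨⟨(mem_X_iff_of_K ends e s T hK hs a).1 hx, (mem_X_iff_of_K ends e s T hK hs b).1 hy⟩, hK⟩
    · rintro ⟨⟨hx, hy⟩, hK⟩
      exact ⟨⟨(mem_X_iff_of_K ends e s T hK hs a).2 hx, (mem_X_iff_of_K ends e s T hK hs b).2 hy⟩, hK⟩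
  have hR : prob p (Rplus ends e s T) =
      ∑ W : Set V, if s ∉ W then prob p (KEvent ends e T W) else 0 := by
    have := hpart Set.univ (fun _ => 1) (fun W _ => by rw [Set.univ_inter, one_mul])
    rw [Set.univ_inter] at this
    simpa only [one_mul] using this
  -- the seed-set BHK under the `e`-open measure with `1 − x̄`, `1 − ȳ`
  have hx_anti : ∀ {W W' : Set V}, W ⊆ W' →
      prob p (Xdel ends e s W' a) ≤ prob p (Xdel ends e s W a) :=
    fun h => prob_mono hp (Xdel_anti ends e s h a)
  have hy_anti : ∀ {W W' : Set V}, W ⊆ W' →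
      prob p (Xdel ends e s W' b) ≤ prob p (Xdel ends e s W b) :=
    fun h => prob_mono hp (Xdel_anti ends e s h b)
  have key := bhk_multi (Function.update p e 1) hp₁ ends T
    (F₁ := fun W => 1 - prob p (Xdel ends e s W a)) (F₂ := fun W => 1 - prob p (Xdel ends e s W b))
    (fun W W' h => by simp only; linarith [hx_anti h]) (fun W W' h => by simp only; linarith [hy_anti h])
    (fun W => sub_nonneg.2 (prob_le_one hp _)) (fun W => sub_nonneg.2 (prob_le_one hp _)) {s} {s}
  rw [Finset.inter_self, Finset.union_self,
    expect_update_one_K p ends e s T (fun W => 1 - prob p (Xdel ends e s W a)),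
    expect_update_one_K p ends e s T (fun W => 1 - prob p (Xdel ends e s W b)),
    expect_update_one_K p ends e s T
      ((fun W => 1 - prob p (Xdel ends e s W a)) * fun W => 1 - prob p (Xdel ends e s W b)),
    CCT.prob_update_one_eq, ← Rplus_eq] at key
  simp only [Pi.mul_apply] at key
  -- expand the sums
  set S := ∑ W : Set V, if s ∉ W then prob p (KEvent ends e T W) else 0 with hS
  set Sx := ∑ W : Set V, if s ∉ W then prob p (Xdel ends e s W a) * prob p (KEvent ends e T W) else 0
  set Sy := ∑ W : Set V, if s ∉ W then prob p (Xdel ends e s W b) * prob p (KEvent ends e T W) else 0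
  set Sxy := ∑ W : Set V, if s ∉ W then
    prob p (Xdel ends e s W a) * prob p (Xdel ends e s W b) * prob p (KEvent ends e T W) else 0
  set SXY := ∑ W : Set V, if s ∉ W then
    prob p (Xdel ends e s W a ∩ Xdel ends e s W b) * prob p (KEvent ends e T W) else 0
  have e1 : (∑ W : Set V, if s ∉ W then (1 - prob p (Xdel ends e s W a)) *
      prob p (KEvent ends e T W) else 0) = S - Sx := by
    rw [hS, ← Finset.sum_sub_distrib]
    refine Finset.sum_congr rfl fun W _ => ?_
    split_ifs <;> ring
  have e2 : (∑ W : Set V, if s ∉ W then (1 - prob p (Xdel ends e s W b)) *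
      prob p (KEvent ends e T W) else 0) = S - Sy := by
    rw [hS, ← Finset.sum_sub_distrib]
    refine Finset.sum_congr rfl fun W _ => ?_
    split_ifs <;> ring
  have e3 : (∑ W : Set V, if s ∉ W then (1 - prob p (Xdel ends e s W a)) *
      (1 - prob p (Xdel ends e s W b)) * prob p (KEvent ends e T W) else 0) =
      S - Sx - Sy + Sxy := by
    rw [hS, ← Finset.sum_sub_distrib, ← Finset.sum_sub_distrib, ← Finset.sum_add_distrib]
    refine Finset.sum_congr rfl fun W _ => ?_
    split_ifs <;> ring
  rw [e1, e2, e3] at key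
  -- Harris termwise: `Sxy ≤ SXY`
  have hHarris : Sxy ≤ SXY := by
    refine Finset.sum_le_sum fun W _ => ?_
    by_cases hs : s ∉ W
    · rw [if_pos hs, if_pos hs]
      exact mul_le_mul_of_nonneg_right
        (prob_mul_prob_le_prob_inter hp (isUpperSet_Xdel ends e s W a)
          (isUpperSet_Xdel ends e s W b)) (prob_nonneg hp _)
    · rw [if_neg hs, if_neg hs]
  have hS0 : 0 ≤ S := Finset.sum_nonneg fun W _ => by
    by_cases hs : s ∉ W
    · rw [if_pos hs]; exact prob_nonneg hp _
    · rw [if_neg hs]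
  rw [hR] at key
  have h1 : Sx * Sy ≤ S * Sxy := by nlinarith [key]
  have h2 : S * Sxy ≤ S * SXY := mul_le_mul_of_nonneg_left hHarris hS0
  rw [hX, hY, hXY, hR]
  change Sx * Sy ≤ SXY * S
  linarith [h1, h2, mul_comm S SXY]

end Main

end PASub

end Summit.Ventures.PercRepro2
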